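import Summits.QuantumFields.BalabanUV.Beta.GAN24.SecondResponseZeroMode
import Summits.QuantumFields.BalabanUV.Beta.GAN24.ExchangeZeroMode
import Summits.QuantumFields.BalabanUV.Beta.GAN24.ChannelBondLegs
import Summits.QuantumFields.BalabanUV.Beta.GAN24.SpureChargeZero
import Summits.QuantumFields.BalabanUV.Beta.SecondOrderUnits

/-!
# `BalabanUV.Beta.GAN24.ResponseExchangeStep` — row G-an2-4 ∕ (CONV-C), W-slot, road «W3» (SKELETON-W3 §7.2 ∕ §8.3 (F2)), «W3-S3C*» PART 6
# step module: THE SECOND-RESPONSE AND EXCHANGE CHANNELS OF THE W3 BRACKET THROUGH an4's DRESSED STEP KERNEL HAVE ZERO ff ZERO MODE —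
# every hypothesis of modules (B1)∕(B2)∕(C2) discharged BY NAME for `K♮ = unitK s_f s_m (KInvStep Lc j)` at blocking `Lc`, `S♮ = unitS s_f s_m
# (Spure … j)` ((S3c) = gen 8's `SpureChargeZero.hasSum_unitS_Spure`), `M♮ = unitM s_f s_m (M1 … j)`; every `j`, every `d`, ALL real units and
# colour constants, `Lc ≥ 1`; plus the `zmode` forms (leaf-16's `zmode_eq_zero_of_inner_eq_zero`)

NOT IN PRINT; OUR BOOKKEEPING (idle-seat kernel lemma, unit `b2b-balaban-gan24-formalise-leaf-06`, gen 9).  HONEST FRAMING (cell contract,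
verbatim): «discharging `BetaPertH` makes Bałaban's UV stability UNCONDITIONAL — a real constructive-QFT result; it is NOT the continuum limit and
NOT the Clay problem.»  HONEST DEPENDENCY (verbatim): «continuum YM on T⁴ ⇐ BetaPertH ∧ nine spine estimates (0/9 proved); BetaPertH ⇐ (D1) ∧ (D4)
∧ CAP+tail; G-an2-4 gates asym, D1 and NE2/3/4.»

WHAT ([folklore]; 0 `def`, 0 cite, 0 sorry):
* §1 the dressed step kernel: `KInvStep_inl_inr_off_right` (multiplier SECOND legs of `KInvStep Lc j` vanish off the `Lc`-coarse lattice, field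
  first leg — the twin of an4's `KInvStep_inr_off` and leaf-14's `KInvStep_inr_inr_off_right`), `unitKStep_off_left∕right`, and the coarse-leg
  charge families `unitKStep_row∕col` (gen 8 `StepResolventLegCharges` dressed by `hasSum_unitK_row∕col`): (Q-lin) on field legs, (S2c) on multiplier legs.
* §2 the tables: `unitS_Spure_translate` (block covariance of `S♮`, an2's `Spure_translate`), `vertexFamily_unitM`, `unitM_translate`, and
  `step_rates` (ONE common rate for `K♮`, `S♮`, `M♮`: an4's `decays_KInvStep`, an2's `locStencil_Spure` ∕ `vertexFamily_M1`, unit transports).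
* §3 THE FOUR CHANNEL IDENTITIES at the step objects, for EVERY first bond `(κ, u)` — **`inner_resp_step_eq_zero`**, **`inner_resp_swap_step_eq_zero`**,
  **`inner_exchange_step_eq_zero`**, **`inner_exchange_swap_step_eq_zero`** — and §4 their `zmode` forms (any period `P`); §5 the same four
  channels in the UNSANDWICHED double-leg currency the ROW W3-F2a assembly consumes (`hasSum_tsum_prod_*_step`: `HasSum (u′ ↦ Σ'_{(v,p)} V u′ v p
  (inl a) (inl b)) 0`, modules (C1) and `ChannelBondLegs`).
READING (docstring level, asserted nowhere in Lean): with leaf-14's `MixedChannelZeroMode` (the mixed channel) and `T2RecursionAffine.vertex2OfK_zero`,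
these are ALL channels of the value part of the source of record `b_j` (gen 8 `ExchangeReadout.K3OfK_apply_eq` + an2's `W2OfK_apply`); ROW W3-F2a's
assembler (leaf-02's lineage) adds them — this file is NOT the row.  Asserts NO shape or value of Bałaban's tables, pins no colour constant;
discharges NOTHING of ROW W3-F2a ∕ F2b, «T2Shape» ∕ «T2SupRate», (hW, hWall); 0 wall binders; NOT «W-slot closed», NEVER «G-an2-4 closed»; NOT
BetaPertH, NOT continuum, NOT Clay.
-/

noncomputable section

open Finset
open scoped BigOperators
open Literature.MathematicalPhysics.QuantumFieldTheory
open Literature.MathematicalPhysics.QuantumFieldTheory.Balaban1983to89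
open Literature.MathematicalPhysics.QuantumFieldTheory.Balaban1983to89.Beta
open Literature.Probability.LatticeModels (Torus.proj)
open ExpKernelCalculus (Site MKer BiLoc Decays VertexFamily comp shiftK)
open OneStepResolventKernel (Fib LocStencil KInv KInv_inl_inr_off decays_mono biLoc_mono)
open OneStepKernelFamily (KInvStep dec legPt decays_KInvStep KInvStep_inr_off proj_pow_smul_eq_zero_iff)
open SecondOrderResponse (dM K2OfK biLoc_smul)
open BalabanStepJets (locStencil_mono)
open BalabanStepJetsSucc (mmRead)
open BalabanStepW2 (Spure M1 locStencil_Spure Spure_translate vertexFamily_M1 M1_translate)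
open Summit.QuantumFields.BalabanUV.Beta.HessKerDressedUnits (unitK unitS legScale unitK_apply unitS_apply decays_unitK locStencil_unitS
  biLoc_counitK)
open Summit.QuantumFields.BalabanUV.Beta.SecondOrderUnits (unitM unitM_apply)
open Summit.QuantumFields.BalabanUV.Beta.GAN24.BiStencilZeroMode (zmode)
open Summit.QuantumFields.BalabanUV.Beta.GAN24.TransversalZeroMode (zmode_eq_zero_of_inner_eq_zero)
open Summit.QuantumFields.BalabanUV.Beta.GAN24.MultiplierZeroMass (KInvStep_inr_inr_off_right)
open Summit.QuantumFields.BalabanUV.Beta.GAN24.StepResolventLegCharges (hasSum_KInvStep_row hasSum_KInvStep_col hasSum_unitK_row hasSum_unitK_col)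
open Summit.QuantumFields.BalabanUV.Beta.GAN24.MixedChannelZeroMode (shiftK_unitK_KInvStep)
open Summit.QuantumFields.BalabanUV.Beta.GAN24.SpureChargeZero (hasSum_unitS_Spure)
open Summit.QuantumFields.BalabanUV.Beta.GAN24.SecondResponseReadout (inner_resp_swap_eq_zero)
open Summit.QuantumFields.BalabanUV.Beta.GAN24.SecondResponseZeroMode (hasSum_inner_resp)
open Summit.QuantumFields.BalabanUV.Beta.GAN24.ExchangeZeroMode (inner_exchange_eq_zero inner_exchange_swap_eq_zero)
open Summit.QuantumFields.BalabanUV.Beta.GAN24.ExchangeBondLegs (hasSum_bond_legs_exchange)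
open Summit.QuantumFields.BalabanUV.Beta.GAN24.ChannelBondLegs (hasSum_tsum_prod_resp_bond hasSum_tsum_prod_resp_swap_bond
  hasSum_tsum_prod_exchange_swap_bond)

namespace Summit.QuantumFields.BalabanUV.Beta.GAN24.ResponseExchangeStep

variable {d : ℕ} {Lc : ℕ} [NeZero Lc]

/-! ## §1 The dressed step kernel `K♮_j = unitK s_f s_m (KInvStep Lc j)` -/

/-- [folklore] Off the `Lc`-coarse lattice in the SECOND argument the field–multiplier entries of `KInvStep Lc j` vanish (the decimation reads the
multiplier leg at the coarse point `Lc^j•z`, where an4's one-shot `KInv` vanishes off the `Lc^{j+1}`-lattice). -/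
theorem KInvStep_inl_inr_off_right (j : ℕ) {z : Site (d + 1)} (hz : Torus.proj Lc z ≠ 0) (x : Site (d + 1)) (κ ρ : Fin (d + 1)) :
    KInvStep (d := d) Lc j x z (Sum.inl κ) (Sum.inr ρ) = 0 := by
  have hz' : Torus.proj (Lc ^ (j + 1)) (((Lc ^ j : ℕ) : ℤ) • z) ≠ 0 := by
    rwa [Ne, proj_pow_smul_eq_zero_iff]
  unfold KInvStep dec
  refine Finset.sum_eq_zero fun i _ => Finset.sum_eq_zero fun i' _ => ?_
  simp only [legPt, KInv_inl_inr_off hz', mul_zero]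

/-- [folklore] Multiplier FIRST legs of the dressed step kernel vanish off the coarse lattice (an4's `KInvStep_inr_off`). -/
theorem unitKStep_off_left (sf sm : ℝ) (j : ℕ) (x z : Site (d + 1)) (ρ : Fin (d + 1)) (b : Fib d) (hx : Torus.proj Lc x ≠ 0) :
    unitK sf sm (KInvStep (d := d) Lc j) x z (Sum.inr ρ) b = 0 := by
  rw [unitK_apply, KInvStep_inr_off j hx ρ b z, mul_zero, zero_mul]

/-- [folklore] Multiplier SECOND legs of the dressed step kernel vanish off the coarse lattice. -/
theorem unitKStep_off_right (sf sm : ℝ) (j : ℕ) (x z : Site (d + 1)) (a : Fib d) (ρ : Fin (d + 1)) (hz : Torus.proj Lc z ≠ 0) :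
    unitK sf sm (KInvStep (d := d) Lc j) x z a (Sum.inr ρ) = 0 := by
  rcases a with κ | μ
  · rw [unitK_apply, KInvStep_inl_inr_off_right j hz x κ ρ, mul_zero, zero_mul]
  · rw [unitK_apply, KInvStep_inr_inr_off_right j hz x μ ρ, mul_zero, zero_mul]

/-- [folklore] **ROW CHARGES OF `K♮_j` AGAINST A MULTIPLIER LEG** (site-free; (Q-lin) on field legs, (S2c) = 0 on multiplier legs). -/
theorem unitKStep_row (sf sm : ℝ) (j : ℕ) (α : Fin (d + 1)) (f : Fib d) (y : Site (d + 1)) :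
    HasSum (fun x' : Site (d + 1) => unitK sf sm (KInvStep (d := d) Lc j) (((Lc : ℕ) : ℤ) • x') y (Sum.inr α) f)
      (sm * Sum.elim (fun a => -(if a = α then ((((Lc ^ (j + 1) : ℕ) : ℝ)) ^ (d + 1 + 1))⁻¹ else 0)) (fun _ => (0 : ℝ)) f *
        legScale sf sm f) :=
  hasSum_unitK_row sf sm (hasSum_KInvStep_row j α f y)

/-- [folklore] **COLUMN CHARGES OF `K♮_j` AGAINST A MULTIPLIER LEG** (site-free; (Q-lin) on field legs, (S2c) = 0 on multiplier legs). -/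
theorem unitKStep_col (sf sm : ℝ) (j : ℕ) (β : Fin (d + 1)) (g : Fib d) (w : Site (d + 1)) :
    HasSum (fun z' : Site (d + 1) => unitK sf sm (KInvStep (d := d) Lc j) w (((Lc : ℕ) : ℤ) • z') g (Sum.inr β))
      (legScale sf sm g * Sum.elim (fun b => if b = β then ((((Lc ^ (j + 1) : ℕ) : ℝ)) ^ (d + 1 + 1))⁻¹ else 0) (fun _ => (0 : ℝ)) g * sm) :=
  hasSum_unitK_col sf sm (hasSum_KInvStep_col j β g w)

/-! ## §2 The tables `S♮_j = unitS s_f s_m (Spure … j)`, `M♮_j = unitM s_f s_m (M1 … j)` and one common rate -/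

/-- [folklore] **BLOCK COVARIANCE OF THE NORMALISED FIRST FIELD TABLE** (an2's `Spure_translate`; leg-type-constant units commute with shifts). -/
theorem unitS_Spure_translate (hLc : 1 ≤ Lc) (sf sm cE cVH cΛ : ℝ) (j : ℕ) (κ : Fin (d + 1)) (u s : Site (d + 1)) :
    unitS sf sm (Spure d Lc cE cVH cΛ j) κ (u + ((Lc : ℕ) : ℤ) • s)
      = shiftK (-(((Lc : ℕ) : ℤ) • s)) (unitS sf sm (Spure d Lc cE cVH cΛ j) κ u) := by
  funext x z a b
  simp only [unitS_apply, shiftK, Spure_translate hLc cE cVH cΛ j κ u s]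

omit [NeZero Lc] in
/-- [folklore] Units transport of a vertex family through `unitM` (`biLoc_counitK`, `biLoc_smul`). -/
theorem vertexFamily_unitM {M : Fin (d + 1) → Site (d + 1) → MKer (d + 1) (Fib d)} {CM δ : ℝ} (hM : VertexFamily M Lc CM δ) (sf sm : ℝ) :
    VertexFamily (unitM sf sm M) Lc (|(sm * sm)⁻¹| * (max |sf⁻¹| |sm⁻¹| * CM * max |sf⁻¹| |sm⁻¹|)) δ :=
  fun ρ w => biLoc_smul ((sm * sm)⁻¹) (biLoc_counitK (hM ρ w))

omit [NeZero Lc] in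
/-- [folklore] Coarse covariance passes through `unitM`. -/
theorem unitM_translate {M : Fin (d + 1) → Site (d + 1) → MKer (d + 1) (Fib d)}
    (hMt : ∀ (ρ : Fin (d + 1)) (w t : Site (d + 1)), M ρ (w + t) = shiftK (-(((Lc : ℕ) : ℤ) • t)) (M ρ w)) (sf sm : ℝ)
    (ρ : Fin (d + 1)) (w t : Site (d + 1)) :
    unitM sf sm M ρ (w + t) = shiftK (-(((Lc : ℕ) : ℤ) • t)) (unitM sf sm M ρ w) := by
  funext x z a b
  simp only [unitM_apply, shiftK, hMt ρ w t]

/-- [folklore] **ONE COMMON RATE** for the dressed step kernel (an4's `decays_KInvStep`), the normalised first field table (an2's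
`locStencil_Spure`) and the normalised multiplier table (an2's `vertexFamily_M1`, any rate). -/
theorem step_rates (hLc : 1 ≤ Lc) (sf sm cE cVH cΛ : ℝ) (j : ℕ) :
    ∃ C Cs CM m : ℝ, 0 < m ∧ Decays (unitK sf sm (KInvStep (d := d) Lc j)) C m ∧
      LocStencil (unitS sf sm (Spure d Lc cE cVH cΛ j)) Cs m ∧ VertexFamily (unitM sf sm (M1 d Lc cΛ j)) Lc CM m := by
  obtain ⟨δK, CK, hδK, hCK, hK⟩ := decays_KInvStep (d := d) (Lc := Lc) j
  obtain ⟨Cs, δS, hδS, hS⟩ := locStencil_Spure (d := d) (Lc := Lc) hLc cE cVH cΛ j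
  have hm : 0 < min δK δS := lt_min hδK hδS
  have hCs : 0 ≤ Cs := (hS 0 0).nonneg (Sum.inl 0)
  exact ⟨_, _, _, min δK δS, hm, decays_mono (decays_unitK hK) (by positivity) le_rfl (min_le_left _ _),
    locStencil_mono (locStencil_unitS hS) (by positivity) (min_le_right _ _),
    vertexFamily_unitM (vertexFamily_M1 hLc cΛ j hm.le) sf sm⟩

/-! ## §3 The four channel identities at the step objects -/

section Channels

variable (hLc : 1 ≤ Lc) (sf sm cE cVH cΛ : ℝ) (j : ℕ)
include hLc

/-- [folklore] **SECOND-RESPONSE CHANNEL, second-bond orientation, THROUGH THE STEP KERNEL**: for every first bond `(κ, u)`,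
`Σ'_{u′} Σ'_{x′} Σ'_{z′} mmRead Lc (K♮ ∘ dM (K2OfK K♮ Lc S♮ M♮ κ′ u′) Lc S♮ M♮ κ u ∘ K♮) x′ z′ (inl α) (inl β) = 0`. -/
theorem inner_resp_step_eq_zero (κ : Fin (d + 1)) (u : Site (d + 1)) (κ' α β : Fin (d + 1)) :
    (∑' u', ∑' x', ∑' z', mmRead Lc (comp (comp (unitK sf sm (KInvStep (d := d) Lc j))
      (dM (K2OfK (unitK sf sm (KInvStep (d := d) Lc j)) Lc (unitS sf sm (Spure d Lc cE cVH cΛ j)) (unitM sf sm (M1 d Lc cΛ j)) κ' u')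
        Lc (unitS sf sm (Spure d Lc cE cVH cΛ j)) (unitM sf sm (M1 d Lc cΛ j)) κ u)) (unitK sf sm (KInvStep (d := d) Lc j)))
        x' z' (Sum.inl α) (Sum.inl β)) = 0 := by
  obtain ⟨C, Cs, CM, m, hm, hK, hS, hM⟩ := step_rates (d := d) hLc sf sm cE cVH cΛ j
  exact (hasSum_inner_resp hK hm (unitKStep_row sf sm j) (unitKStep_col sf sm j) (fun α μ => by simp) (fun β μ => by simp)
    (fun x z ρ b hx => unitKStep_off_left sf sm j x z ρ b hx) hS
    (fun κ t a b => (hasSum_unitS_Spure hLc sf sm cE cVH cΛ j κ a b t).1)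
    (fun κ q a b => (hasSum_unitS_Spure hLc sf sm cE cVH cΛ j κ a b q).2.1)
    (unitS_Spure_translate hLc sf sm cE cVH cΛ j) hM (unitM_translate (M1_translate cΛ j) sf sm) κ u κ' α β).tsum_eq

/-- [folklore] **SECOND-RESPONSE CHANNEL, first-bond (swapped) orientation, THROUGH THE STEP KERNEL**. -/
theorem inner_resp_swap_step_eq_zero (κ : Fin (d + 1)) (u : Site (d + 1)) (κ' α β : Fin (d + 1)) :
    (∑' u', ∑' x', ∑' z', mmRead Lc (comp (comp (unitK sf sm (KInvStep (d := d) Lc j))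
      (dM (K2OfK (unitK sf sm (KInvStep (d := d) Lc j)) Lc (unitS sf sm (Spure d Lc cE cVH cΛ j)) (unitM sf sm (M1 d Lc cΛ j)) κ u)
        Lc (unitS sf sm (Spure d Lc cE cVH cΛ j)) (unitM sf sm (M1 d Lc cΛ j)) κ' u')) (unitK sf sm (KInvStep (d := d) Lc j)))
        x' z' (Sum.inl α) (Sum.inl β)) = 0 := by
  obtain ⟨C, Cs, CM, m, hm, hK, hS, hM⟩ := step_rates (d := d) hLc sf sm cE cVH cΛ j
  exact inner_resp_swap_eq_zero hK hm (unitKStep_row sf sm j) (unitKStep_col sf sm j) (fun α μ => by simp) (fun β μ => by simp) hS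
    (fun κ t a b => (hasSum_unitS_Spure hLc sf sm cE cVH cΛ j κ a b t).1)
    hM (unitM_translate (M1_translate cΛ j) sf sm) κ u κ' α β

/-- [folklore] **EXCHANGE CHANNEL, summed bond in the second factor, THROUGH THE STEP KERNEL**: for every first bond `(κ, u)`,
`Σ'_{u′} Σ'_{x′} Σ'_{z′} mmRead Lc ((K♮ ∘ dM K♮ Lc S♮ M♮ κ u) ∘ ((K♮ ∘ dM K♮ Lc S♮ M♮ κ′ u′) ∘ K♮)) x′ z′ (inl α) (inl β) = 0`. -/
theorem inner_exchange_step_eq_zero (κ : Fin (d + 1)) (u : Site (d + 1)) (κ' α β : Fin (d + 1)) :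
    (∑' u', ∑' x', ∑' z', mmRead Lc (comp
      (comp (unitK sf sm (KInvStep (d := d) Lc j))
        (dM (unitK sf sm (KInvStep (d := d) Lc j)) Lc (unitS sf sm (Spure d Lc cE cVH cΛ j)) (unitM sf sm (M1 d Lc cΛ j)) κ u))
      (comp (comp (unitK sf sm (KInvStep (d := d) Lc j))
        (dM (unitK sf sm (KInvStep (d := d) Lc j)) Lc (unitS sf sm (Spure d Lc cE cVH cΛ j)) (unitM sf sm (M1 d Lc cΛ j)) κ' u'))
        (unitK sf sm (KInvStep (d := d) Lc j)))) x' z' (Sum.inl α) (Sum.inl β)) = 0 := by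
  obtain ⟨C, Cs, CM, m, hm, hK, hS, hM⟩ := step_rates (d := d) hLc sf sm cE cVH cΛ j
  exact inner_exchange_eq_zero hK hm (unitKStep_row sf sm j) (unitKStep_col sf sm j) (fun α μ => by simp) (fun β μ => by simp)
    (fun x z a ρ hz => unitKStep_off_right sf sm j x z a ρ hz) hS
    (fun κ t a b => (hasSum_unitS_Spure hLc sf sm cE cVH cΛ j κ a b t).1)
    (fun κ p a b => (hasSum_unitS_Spure hLc sf sm cE cVH cΛ j κ a b p).2.2)
    (unitS_Spure_translate hLc sf sm cE cVH cΛ j) hM (unitM_translate (M1_translate cΛ j) sf sm) κ u κ' α β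

/-- [folklore] **EXCHANGE CHANNEL, summed bond in the first factor, THROUGH THE STEP KERNEL**. -/
theorem inner_exchange_swap_step_eq_zero (κ : Fin (d + 1)) (u : Site (d + 1)) (κ' α β : Fin (d + 1)) :
    (∑' u', ∑' x', ∑' z', mmRead Lc (comp
      (comp (unitK sf sm (KInvStep (d := d) Lc j))
        (dM (unitK sf sm (KInvStep (d := d) Lc j)) Lc (unitS sf sm (Spure d Lc cE cVH cΛ j)) (unitM sf sm (M1 d Lc cΛ j)) κ' u'))
      (comp (comp (unitK sf sm (KInvStep (d := d) Lc j))
        (dM (unitK sf sm (KInvStep (d := d) Lc j)) Lc (unitS sf sm (Spure d Lc cE cVH cΛ j)) (unitM sf sm (M1 d Lc cΛ j)) κ u))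
        (unitK sf sm (KInvStep (d := d) Lc j)))) x' z' (Sum.inl α) (Sum.inl β)) = 0 := by
  obtain ⟨C, Cs, CM, m, hm, hK, hS, hM⟩ := step_rates (d := d) hLc sf sm cE cVH cΛ j
  exact inner_exchange_swap_eq_zero hK hm (shiftK_unitK_KInvStep sf sm j) (unitKStep_row sf sm j) (unitKStep_col sf sm j)
    (fun α μ => by simp) (fun β μ => by simp) (fun x z a ρ hz => unitKStep_off_right sf sm j x z a ρ hz) hS
    (fun κ t a b => (hasSum_unitS_Spure hLc sf sm cE cVH cΛ j κ a b t).1)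
    (fun κ p a b => (hasSum_unitS_Spure hLc sf sm cE cVH cΛ j κ a b p).2.2)
    (unitS_Spure_translate hLc sf sm cE cVH cΛ j) hM (unitM_translate (M1_translate cΛ j) sf sm) κ u κ' α β

/-! ## §4 The `zmode` forms (any period `P`) -/

/-- [folklore] `zmode` form of `inner_resp_step_eq_zero`. -/
theorem zmode_resp_step_eq_zero (P : ℕ) (κ κ' α β : Fin (d + 1)) :
    zmode P (fun κ u κ' u' => mmRead Lc (comp (comp (unitK sf sm (KInvStep (d := d) Lc j))
      (dM (K2OfK (unitK sf sm (KInvStep (d := d) Lc j)) Lc (unitS sf sm (Spure d Lc cE cVH cΛ j)) (unitM sf sm (M1 d Lc cΛ j)) κ' u')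
        Lc (unitS sf sm (Spure d Lc cE cVH cΛ j)) (unitM sf sm (M1 d Lc cΛ j)) κ u)) (unitK sf sm (KInvStep (d := d) Lc j))))
      κ κ' (Sum.inl α) (Sum.inl β) = 0 :=
  zmode_eq_zero_of_inner_eq_zero P fun u => inner_resp_step_eq_zero hLc sf sm cE cVH cΛ j κ u κ' α β

/-- [folklore] `zmode` form of `inner_resp_swap_step_eq_zero`. -/
theorem zmode_resp_swap_step_eq_zero (P : ℕ) (κ κ' α β : Fin (d + 1)) :
    zmode P (fun κ u κ' u' => mmRead Lc (comp (comp (unitK sf sm (KInvStep (d := d) Lc j))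
      (dM (K2OfK (unitK sf sm (KInvStep (d := d) Lc j)) Lc (unitS sf sm (Spure d Lc cE cVH cΛ j)) (unitM sf sm (M1 d Lc cΛ j)) κ u)
        Lc (unitS sf sm (Spure d Lc cE cVH cΛ j)) (unitM sf sm (M1 d Lc cΛ j)) κ' u')) (unitK sf sm (KInvStep (d := d) Lc j))))
      κ κ' (Sum.inl α) (Sum.inl β) = 0 :=
  zmode_eq_zero_of_inner_eq_zero P fun u => inner_resp_swap_step_eq_zero hLc sf sm cE cVH cΛ j κ u κ' α β

/-- [folklore] `zmode` form of `inner_exchange_step_eq_zero`. -/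
theorem zmode_exchange_step_eq_zero (P : ℕ) (κ κ' α β : Fin (d + 1)) :
    zmode P (fun κ u κ' u' => mmRead Lc (comp
      (comp (unitK sf sm (KInvStep (d := d) Lc j))
        (dM (unitK sf sm (KInvStep (d := d) Lc j)) Lc (unitS sf sm (Spure d Lc cE cVH cΛ j)) (unitM sf sm (M1 d Lc cΛ j)) κ u))
      (comp (comp (unitK sf sm (KInvStep (d := d) Lc j))
        (dM (unitK sf sm (KInvStep (d := d) Lc j)) Lc (unitS sf sm (Spure d Lc cE cVH cΛ j)) (unitM sf sm (M1 d Lc cΛ j)) κ' u'))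
        (unitK sf sm (KInvStep (d := d) Lc j)))))
      κ κ' (Sum.inl α) (Sum.inl β) = 0 :=
  zmode_eq_zero_of_inner_eq_zero P fun u => inner_exchange_step_eq_zero hLc sf sm cE cVH cΛ j κ u κ' α β

/-- [folklore] `zmode` form of `inner_exchange_swap_step_eq_zero`. -/
theorem zmode_exchange_swap_step_eq_zero (P : ℕ) (κ κ' α β : Fin (d + 1)) :
    zmode P (fun κ u κ' u' => mmRead Lc (comp
      (comp (unitK sf sm (KInvStep (d := d) Lc j))
        (dM (unitK sf sm (KInvStep (d := d) Lc j)) Lc (unitS sf sm (Spure d Lc cE cVH cΛ j)) (unitM sf sm (M1 d Lc cΛ j)) κ' u'))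
      (comp (comp (unitK sf sm (KInvStep (d := d) Lc j))
        (dM (unitK sf sm (KInvStep (d := d) Lc j)) Lc (unitS sf sm (Spure d Lc cE cVH cΛ j)) (unitM sf sm (M1 d Lc cΛ j)) κ u))
        (unitK sf sm (KInvStep (d := d) Lc j)))))
      κ κ' (Sum.inl α) (Sum.inl β) = 0 :=
  zmode_eq_zero_of_inner_eq_zero P fun u => inner_exchange_swap_step_eq_zero hLc sf sm cE cVH cΛ j κ u κ' α β

/-! ## §5 The unsandwiched double-leg bond sums at the step objects (the ROW W3-F2a assembly's binder shape) -/

/-- [folklore] `HasSum (u′ ↦ Σ'_{(v,p)} dM (K2OfK K♮ Lc S♮ M♮ κ′ u′) Lc S♮ M♮ κ u v p (inl a) (inl b)) 0` at the step objects. -/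
theorem hasSum_tsum_prod_resp_step (κ : Fin (d + 1)) (u : Site (d + 1)) (κ' a b : Fin (d + 1)) :
    HasSum (fun u' : Site (d + 1) => ∑' vp : Site (d + 1) × Site (d + 1),
      dM (K2OfK (unitK sf sm (KInvStep (d := d) Lc j)) Lc (unitS sf sm (Spure d Lc cE cVH cΛ j)) (unitM sf sm (M1 d Lc cΛ j)) κ' u')
        Lc (unitS sf sm (Spure d Lc cE cVH cΛ j)) (unitM sf sm (M1 d Lc cΛ j)) κ u vp.1 vp.2 (Sum.inl a) (Sum.inl b)) 0 := by
  obtain ⟨C, Cs, CM, m, hm, hK, hS, hM⟩ := step_rates (d := d) hLc sf sm cE cVH cΛ j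
  exact hasSum_tsum_prod_resp_bond hK hm (unitKStep_row sf sm j) (unitKStep_col sf sm j) (fun α μ => by simp) (fun β μ => by simp)
    (fun x z ρ b hx => unitKStep_off_left sf sm j x z ρ b hx) hS
    (fun κ t a b => (hasSum_unitS_Spure hLc sf sm cE cVH cΛ j κ a b t).1)
    (fun κ q a b => (hasSum_unitS_Spure hLc sf sm cE cVH cΛ j κ a b q).2.1)
    (unitS_Spure_translate hLc sf sm cE cVH cΛ j) hM (unitM_translate (M1_translate cΛ j) sf sm) κ u κ' a b

/-- [folklore] `HasSum (u′ ↦ Σ'_{(v,p)} dM (K2OfK K♮ Lc S♮ M♮ κ u) Lc S♮ M♮ κ′ u′ v p (inl a) (inl b)) 0` at the step objects. -/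
theorem hasSum_tsum_prod_resp_swap_step (κ : Fin (d + 1)) (u : Site (d + 1)) (κ' a b : Fin (d + 1)) :
    HasSum (fun u' : Site (d + 1) => ∑' vp : Site (d + 1) × Site (d + 1),
      dM (K2OfK (unitK sf sm (KInvStep (d := d) Lc j)) Lc (unitS sf sm (Spure d Lc cE cVH cΛ j)) (unitM sf sm (M1 d Lc cΛ j)) κ u)
        Lc (unitS sf sm (Spure d Lc cE cVH cΛ j)) (unitM sf sm (M1 d Lc cΛ j)) κ' u' vp.1 vp.2 (Sum.inl a) (Sum.inl b)) 0 := by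
  obtain ⟨C, Cs, CM, m, hm, hK, hS, hM⟩ := step_rates (d := d) hLc sf sm cE cVH cΛ j
  exact hasSum_tsum_prod_resp_swap_bond hK hm (unitKStep_row sf sm j) (unitKStep_col sf sm j) (fun α μ => by simp) (fun β μ => by simp) hS
    (fun κ t a b => (hasSum_unitS_Spure hLc sf sm cE cVH cΛ j κ a b t).1)
    hM (unitM_translate (M1_translate cΛ j) sf sm) κ u κ' a b

/-- [folklore] `HasSum (u′ ↦ Σ'_{(v,w)} ((dM K♮ Lc S♮ M♮ κ u ∘ K♮) ∘ dM K♮ Lc S♮ M♮ κ′ u′)(v, w)_{(inl a, inl b)}) 0` at the step objects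
(module (C1) `hasSum_bond_legs_exchange` instantiated). -/
theorem hasSum_tsum_prod_exchange_step (κ : Fin (d + 1)) (u : Site (d + 1)) (κ' a b : Fin (d + 1)) :
    HasSum (fun u' : Site (d + 1) => ∑' vw : Site (d + 1) × Site (d + 1),
      comp (comp (dM (unitK sf sm (KInvStep (d := d) Lc j)) Lc (unitS sf sm (Spure d Lc cE cVH cΛ j)) (unitM sf sm (M1 d Lc cΛ j)) κ u)
        (unitK sf sm (KInvStep (d := d) Lc j)))
        (dM (unitK sf sm (KInvStep (d := d) Lc j)) Lc (unitS sf sm (Spure d Lc cE cVH cΛ j)) (unitM sf sm (M1 d Lc cΛ j)) κ' u')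
        vw.1 vw.2 (Sum.inl a) (Sum.inl b)) 0 := by
  obtain ⟨C, Cs, CM, m, hm, hK, hS, hM⟩ := step_rates (d := d) hLc sf sm cE cVH cΛ j
  exact hasSum_bond_legs_exchange hK hm (unitKStep_row sf sm j) (unitKStep_col sf sm j) (fun α μ => by simp) (fun β μ => by simp)
    (fun x z a ρ hz => unitKStep_off_right sf sm j x z a ρ hz) hS
    (fun κ t a b => (hasSum_unitS_Spure hLc sf sm cE cVH cΛ j κ a b t).1)
    (fun κ p a b => (hasSum_unitS_Spure hLc sf sm cE cVH cΛ j κ a b p).2.2)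
    (unitS_Spure_translate hLc sf sm cE cVH cΛ j) hM (unitM_translate (M1_translate cΛ j) sf sm) κ u κ' a b

/-- [folklore] `HasSum (u′ ↦ Σ'_{(v,w)} ((dM K♮ Lc S♮ M♮ κ′ u′ ∘ K♮) ∘ dM K♮ Lc S♮ M♮ κ u)(v, w)_{(inl a, inl b)}) 0` at the step objects
(`ChannelBondLegs.hasSum_tsum_prod_exchange_swap_bond` instantiated). -/
theorem hasSum_tsum_prod_exchange_swap_step (κ : Fin (d + 1)) (u : Site (d + 1)) (κ' a b : Fin (d + 1)) :
    HasSum (fun u' : Site (d + 1) => ∑' vw : Site (d + 1) × Site (d + 1),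
      comp (comp (dM (unitK sf sm (KInvStep (d := d) Lc j)) Lc (unitS sf sm (Spure d Lc cE cVH cΛ j)) (unitM sf sm (M1 d Lc cΛ j)) κ' u')
        (unitK sf sm (KInvStep (d := d) Lc j)))
        (dM (unitK sf sm (KInvStep (d := d) Lc j)) Lc (unitS sf sm (Spure d Lc cE cVH cΛ j)) (unitM sf sm (M1 d Lc cΛ j)) κ u)
        vw.1 vw.2 (Sum.inl a) (Sum.inl b)) 0 := by
  obtain ⟨C, Cs, CM, m, hm, hK, hS, hM⟩ := step_rates (d := d) hLc sf sm cE cVH cΛ j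
  exact hasSum_tsum_prod_exchange_swap_bond hK hm (shiftK_unitK_KInvStep sf sm j) (unitKStep_row sf sm j) (unitKStep_col sf sm j)
    (fun α μ => by simp) (fun β μ => by simp) (fun x z a ρ hz => unitKStep_off_right sf sm j x z a ρ hz) hS
    (fun κ t a b => (hasSum_unitS_Spure hLc sf sm cE cVH cΛ j κ a b t).1)
    (fun κ p a b => (hasSum_unitS_Spure hLc sf sm cE cVH cΛ j κ a b p).2.2)
    (unitS_Spure_translate hLc sf sm cE cVH cΛ j) hM (unitM_translate (M1_translate cΛ j) sf sm) κ u κ' a b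

end Channels

end Summit.QuantumFields.BalabanUV.Beta.GAN24.ResponseExchangeStep

end
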